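import Mathlib
import HarnessLib
import HarnessLib.Audit
import Summits.AtomisticToContinuum.Statement

/-!
Route: OneParticleInfluence

CLOSED (retired) 2026-08-15T13:45:06Z by operator:999:1257524 — reason: not-a-thesis: assembly does not conclude the sub-problem Statement — note: D-0027 §2.1 audit (human 2026-08-15: routes that do not decide the summit are removed): the assembly concludes `Literature.MathematicalPhysics.KineticTheory.HydrodynamicLimit`, not the sub-problem statement; a NEW conforming route may be opened from the same idea (generated `closes : … → _root_.Hydr. The file is kept as the record of this route; refuted decls are indexed as negative knowledge (`ledger negatives`).

# Route OneParticleInfluence — Glauber calculus on the initial data — the Euler limit from the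
one-particle influence of hard spheres (score identity + Efron–Stein)

X = X_A ∧ X_B ∧ X_C ("it suffices to show"), realising card one-particle-influence (spine; crux 1 in
the DRESSED form demanded by its
triage). Do calculus on the INITIAL local-Gibbs data, not on the dynamics. X_A
(ScoreLinearResponse): along a smooth pre-shock homotopy
κ ∈ [0,1] of profiles from a constant state to the target, the covariance of the initial SCORE S_κ =
Σ_i ∂_κ log(a_κ M_{u_κ,θ_κ})(z_i)
with the time-t empirical field converges, uniformly in κ, to the κ-derivative of the classical
hs-Euler solution — by the exact score
identity d/dκ E_κ F_t = Cov_κ(S_κ, F_t) = (N+1)·Cov_κ(s_κ(z₀), E_κ[F_t | z₀]) this is a statement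
about the conditional mean response of
the fluid to ONE tagged sphere. X_B (ResamplingInfluence): resampling one sphere's initial state
moves the time-t field by o(N^{-1/2}) in
L² (total Efron–Stein energy Σ_i E Var(F_t | z_{−i}) → 0). X_C (HardCorePoincare): uniform-in-N
Poincaré/Efron–Stein inequality for the
canonical hard-core local Gibbs law at small packing fraction. Mean from X_A integrated in κ from
the flow-invariant constant state
(supports HomogeneousInvariance, PreShockHomotopy), variance from X_C + X_B; typed waypoint = the
shared L2HydroFields (0800), then
Chebyshev (0801).
Lean: `ScoreLinearResponse ∧ ResamplingInfluence ∧ HardCorePoincare`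

## Assembly
Given profiles (a₁,u₁,θ₁) take Λ from PreShockHomotopy and σ₀ = min of the five antecedents' σ₀
(ScoreLinearResponse at that Λ). For
σ < σ₀, a classical solution on [0,T), flows Φ, the t = 0 hypothesis and t < T: PreShockHomotopy
gives T' > t, the path and the Euler
family with exactly the hypotheses of ScoreLinearResponse; the finite-N SCORE IDENTITY E_{p_1}F_t −
E_{p_0}F_t = ∫₀¹ Cov_{p_κ}(S_κ,F_t) dκ
(differentiate the canonical density under the integral; Z_κ > 0 from the IsProbabilityMeasure
clause) and the UNIFORM limit give
E_{p_1}F_t − E_{p_0}F_t → ⟨U_1(t),χ⟩ − ⟨U_0(t),χ⟩ (FTC in κ, joint smoothness);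
HomogeneousInvariance and the κ = 0 LLN at time 0 (uniform
integrability from Gaussian velocity moments and conserved kinetic energy) give E_{p_0}F_t =
E_{p_0}F_0 → ⟨U_0(0),χ⟩ = ⟨U_0(t),χ⟩ (constant
member). HardCorePoincare at the target profile and ResamplingInfluence give Var_{p_1}(F_t) → 0.
Mean square → 0 is L2HydroFields at
(σ,t,χ); Markov/Chebyshev in ℝ≥0∞ (item 0801, proof in evidence) gives TendstoHydroFieldsAt, i.e.
HydrodynamicLimitFor σ for all σ < σ₀,
hence HydrodynamicLimit profile-wise (hydrodynamicLimit_iff).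

Rationale: WHY THIS LINE. The mechanism is Glauber calculus with respect to the random initial data of a
DETERMINISTIC particle system — the Glauber derivative
D_k F_t = F_t − E[F_t | z_{−k}] of the time-t macroscopic field, controlled in conditional mean
(X_A: hydrodynamic Green's-function
response to one tagged sphere) and in L² (X_B), with concentration from a spectral gap of the
"resample one sphere" dynamics of the
initial Gibbs law (X_C) — exactly the architecture of Duerinckx2021 (arXiv:1912.01366 §2–3: Lemma 1
Efron–Stein, Prop. 1 sensitivity
O(1/N) by Grönwall, linearised Vlasov as first-order response) for MEAN-FIELD Newton dynamics, and
of GloriaNeukammOtto2014 (vertical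
derivative + spectral gap ⇒ fluctuation bounds) in stochastic homogenisation; imported here with the
explicit dictionary: iid data ↦
canonical hard-core local Gibbs law (gap: Bertini2002 Thm 2.2 under (CE), HelmuthPerkinsPetti2022,
EfronStein1981 for products);
pathwise Grönwall sensitivity ↦ impossible (N^{1/3} collisions per particle per unit time, Lyapunov
cascade) and replaced by
CONDITIONAL-MEAN / L² sensitivity; linearised Vlasov ↦ linearised compressible hs-Euler (Spohn1991
§7.1 (7.13)–(7.19), Landau–Placzek);
propagation of chaos for the mean ↦ a large-amplitude SCORE-IDENTITY homotopy (likelihood-ratio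
sensitivity, LastPenrose2017 Thm 19.1
for the Poisson analogue). What it does that the five open routes do not: no relative-entropy
Gronwall and no classification of stationary
states (RelEntropyErgodic, VanishingNoise, ChaoticMixing), no BBGKY/cumulant expansion in collision
histories (DenseKineticExpansion),
no PDE-side measure-valued selection (DissipativeWeakStrong): the whole closure problem is
concentrated in two statements about ONE
particle, measured only in L² of macroscopic observables, never pathwise (contrast
Lanford1975/BGSSAnnals2023 pseudo-trajectories at
Boltzmann–Grad). Negatives index empty at filing.

RANKED CRUXES. #0 L2HydroFields (target) — the shared typed waypoint L2HydroFields
(stmt-AtomisticToContinuum-0800): mean-square convergence of the three empirical fields at every t <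
T under the local Gibbs law; this route is a third entrance into it (mean via ScoreLinearResponse
integrated along PreShockHomotopy from the flow-invariant constant state, variance via
HardCorePoincare + ResamplingInfluence); L2HydroFields → HydrodynamicLimit is the shared Chebyshev
item 0801 (proof in evidence). (why it might fail: in substance the open conjunct itself (L² ⇔ in
probability here by energy conservation); deterministic spheres at fixed σ may fail to keep local
equilibrium on Euler times (Spohn1991 I.3).) [Spohn1991, OllaVaradhanYau1993]
#2 ScoreLinearResponse (crux) — SCORE LINEAR RESPONSE (card crux 1, integrated/dressed form): for
the target profile (a₁,u₁,θ₁), every Λ ≥ 1 and σ < σ₀(a₁,u₁,θ₁,Λ): along any smooth path κ ∈ [0,1]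
of profiles (a_κ,u₀κ,θ₀κ) with constant start, endpoint (a₁,u₁,θ₁) and activities in the Λ-hull of
a₁, and any jointly smooth family of classical hs-Euler solutions U_κ on [0,T) whose data are the
LLN fields of the κ-profiles, for t < T and continuous χ: Cov_{p_κ^N}(S_κ, ⟨U_N(t),χ⟩) →
∂_κ⟨U_κ(t),χ⟩ UNIFORMLY in κ ∈ [0,1] (density, momentum components, energy), where S_κ(z) = Σ_i ∂_κ
log localGibbsProfile(a_κ,u₀κ,θ₀κ)(z_i) is the score of the local Gibbs family. Exact score
identity: Cov_κ(S_κ,F) = d/dκ E_κ F; exchangeability: = (N+1)·Cov_κ(s_κ(z₀), E_κ[F_t|z₀]) — the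
conditional mean response m_t(z₀) = E[F_t|z₀] − E F_t of the fluid to ONE tagged sphere, whose
intended identification (layer 2) is m_t = 𝒢^κ_t[m_0] + o(1/N) in L² (linearised hs-Euler transport
of the DRESSED static imprint; sound shell + entropy mode). κ = 0 case = EquilibriumLinearResponse
(Spohn1991 (7.19) in response form); t = 0 case = StaticScoreResponse. [difficulty: open-problem]
(why it might fail: Open even at global equilibrium (Spohn1991 (7.19): Euler-scale time correlations
unproved for deterministic models except hard rods); an O(1) non-hydrodynamic memory of the tagged
sphere surviving N^(1/3) collision times (kinetic/ring modes) adds a non-Euler term.) [Spohn1991,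
Duerinckx2021, LastPenrose2017, arXiv:1912.01366, EvansMorriss2008]
#3 ResamplingInfluence (crux) — ONE-PARTICLE RESAMPLING INFLUENCE (card crux 2): for the target
local Gibbs law p_N, a pre-shock classical solution matching the data, t < T and continuous χ: Σ_i
E_p[Var_p(F_t | z_{−i})] → 0 for F_t = ⟨U_N(t),χ⟩ (density, momentum components, energy) —
resampling ONE sphere's initial state from its conditional law given the others moves the time-t
macroscopic field by o(N^{-1/2}) in L² (by exchangeability the sum is (N+1)·E Var(F_t|z_{−0}) =
(N+1)·E|D₀F_t|²). Two-copy comparison in L² of a macroscopic observable only, never pathwise.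
Fluctuating-hydrodynamics bookkeeping: transported fluctuation changes by O(1/N),
cascade-re-randomised noise has Euler-scale size N^{-1/2}Kn^{1/2} = N^{-2/3}, so the sum is ~
N^{-1/3} → 0. Mean-field analogue Duerinckx2021 Prop. 1 (O(1/N) by Grönwall), unavailable here.
[difficulty: open-problem] (why it might fail: If Euler-scale fluctuation fields are NOT
deterministically transported (failure of Spohn1991 (7.13) for hard spheres) the cascade
re-randomises the whole O(N^-1/2) fluctuation and the sum stays O(1): crux false, conjunct untouched
(superconcentration/chaos regime).) [Spohn1991, Duerinckx2021, EfronStein1981, Chatterjee2016]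
#4 HardCorePoincare (crux) — CANONICAL HARD-CORE POINCARÉ / EFRON–STEIN (card crux 3): for
continuous a₁ > 0 (and any θ₁ > 0, u₁ — velocities are conditionally independent Maxwellians) there
is σ₀ such that for σ < σ₀ the canonical local Gibbs law p_N of N+1 spheres of diameter
σ(N+1)^(-1/3) on 𝕋³ satisfies Var_p(F) ≤ C Σ_i E_p[Var_p(F | z_{−i})] for all F ∈ L²(p_N), C uniform
in N (and in the flow label): a uniform spectral gap of the heat-bath "resample one sphere" Glauber
dynamics of the CANONICAL inhomogeneous hard-core gas at small packing fraction. Products: C = 1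
(EfronStein1981, Duerinckx2021 Lemma 1); grand-canonical finite-range ϕ ≥ 0 under (CE) zξ/(1−2zξ) <
1: Bertini2002 Thm 2.2 p5, uniform in volume and boundary condition; low-fugacity hard spheres:
HelmuthPerkinsPetti2022. Only the target profile (κ = 1) is used by the Assembly. [difficulty: L]
(why it might fail: Hard core is the ϕ=+∞ limit of BCC's potentials and the ensemble is CANONICAL
with inhomogeneous activity: the fixed-N constraint couples all spheres at O(1/N), summed over N+1
resamplings this is O(1) — exactly borderline for a uniform constant.) [Bertini2002,
HelmuthPerkinsPetti2022, EfronStein1981, doi:10.1016/s0246-0203(01)01085-8, doi:10.1214/21-aap1728]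
#9 HomogeneousInvariance (support) — the canonical law with CONSTANT profiles (c, ū, θ̄) is
invariant under every hard-sphere flow, lawAt Φ p t = p: its density 1_D Π_i M_{ū,θ̄}(v_i)/Z is a
function of kinetic energy and total momentum; Liouville preservation
(HardSphereFlow.measurePreserving), energy conservation
(IsHardSphereTrajectory.configEnergy_eq_holds), momentum conservation (configMomentum_freeFlight /
configMomentum_collidePair along isTrajectory), invariance of the good set. Gives E_{p_0}[F_t] =
E_{p_0}[F_0] at the κ = 0 end of the homotopy; rests on PROVED cone facts. [difficulty:
provable-now] [GST2013, CIP1994, Alexander1975]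
#9 StaticScoreResponse (support) — t = 0 case of ScoreLinearResponse (equilibrium statistical
mechanics only, no flow): along a smooth profile path with activities in the Λ-hull of a₁, if
ρ₀(κ,·) are the LLN density profiles (hypothesis), then Cov_{p_κ^N}(S_κ, ⟨U_N(0),χ⟩) → ∂_κ ∫χ·(ρ₀,
ρ₀u₀, ρ₀(|u₀|²/2 + 3θ₀/2))_κ uniformly in κ: differentiability of the canonical one-point density in
the activity profile, uniformly in N, at small packing fraction (cluster expansion; canonical
corrections O(1/N) summed against the score); velocity parts are Gaussian computations. [difficulty:
M] [Ruelle1969, LebowitzPenrose1964, HelmuthPerkinsPetti2022]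
#9 EquilibriumLinearResponse (support) — GLOBAL-EQUILIBRIUM special case (κ = 0) of
ScoreLinearResponse: same hypotheses, conclusion only at κ = 0 where p_0 is the homogeneous
canonical Gibbs law: Cov_eq(Σ_i s_0(z_i), ⟨U_N(t),χ⟩) → ∂_κ|_0 ⟨U_κ(t),χ⟩ = linearised hs-Euler
about the constant state applied to the initial perturbation. This is the LINEAR-RESPONSE form of
Spohn1991 Part II §7.1 (7.19) / Landau–Placzek: Euler-scale equilibrium time correlations of the
conserved fields of hard spheres are transported by linearised Euler (sound modes, entropy/shear
modes) — open for every deterministic model except hard rods; first foothold for provers, MD check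
for refuters. [difficulty: open-problem] [Spohn1991, EvansMorriss2008, Resibois1978]
#9 PreShockHomotopy (support) — PRE-SHOCK HOMOTOPY WITH LOCAL-GIBBS MATCHING (card crux 4 +
statics): for the target profile there are Λ ≥ 1 and σ₀ such that for σ < σ₀, every classical
hs-Euler solution (ρ,u,θ) on [0,T) whose data are the LLN fields of (a₁,u₁,θ₁), every family of
flows and every t < T, there is T' > t and a smooth path κ ↦ (a_κ,u₀κ,θ₀κ) from constants to
(a₁,u₁,θ₁) with activities in the Λ-hull of a₁, plus a jointly smooth family of classical solutions
on [0,T') with κ=1 member (ρ,u,θ), constant κ=0 member, data = LLN fields of the κ-profiles, all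
laws probability measures (the exact hypothesis list of ScoreLinearResponse). Splits into (i) PDE:
smooth dependence on data and lower-semicontinuous life span for the symmetrisable hyperbolic
hs-Euler system (Kato 1975, Majda1984 Thm 2.1, HsEosLowDensity 0768), a path dodging earlier shocks
(amplitude reduction toward the mean state; the scaling (ρ,λu,λ²θ)(λt) multiplies the life span by
1/λ); (ii) statics: activity ↦ LLN density is a smooth local diffeomorphism with hull control at
small packing (cluster expansion + implicit function theorem; LocalGibbsConcentration 0767). Why it
might fail: life span is not monotone along naive linear interpolation; only SOME path is claimed.
[difficulty: M] [Majda1984, Sideris1985, Ruelle1969, LebowitzPenrose1964]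

TWO-LAYER PLAN. ScoreLinearResponse ⇐ OneParticleGreenResponse (m_t(z₀) = 𝒢^κ_t[m_0(z₀)] + o(1/N) in
L²(p^(1)), after definition LinearizedHsEuler) →
CauchySchwarzGlue ((N+1)·‖s_κ‖_L² · o(1/N) → 0, plus StaticScoreResponse and the chain rule 𝒢_t
∂_κU_κ(0) = ∂_κU_κ(t)) → ScoreLinearResponse;
alternatively by regime: EquilibriumLinearResponse (small amplitude) → LocalEquilibriumExtension →
ScoreLinearResponse.
ResamplingInfluence ⇐ TransportedPart (O(1/N): linearised-Euler transport of the one-sphere change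
of the initial fluctuation field) →
CascadeNoisePart (E|D₀η_t|² ≲ N^(-4/3)) → ResamplingInfluence. PreShockHomotopy ⇐ DataSpaceHomotopy
(pure PDE) → ActivityDensityInverse
(statics) → PreShockHomotopy. k ≤ 3 each, depth 1; nothing filed now.

KILL CRITERIA. ¬EquilibriumLinearResponse (Euler-scale equilibrium time correlations of hard spheres
at arbitrarily small packing NOT given by linearised
Euler) refutes ScoreLinearResponse: close `refuted:ScoreLinearResponse` — and record it as a
summit-level negative (Spohn's fluctuation
picture fails). ¬ResamplingInfluence by a lower bound Σ_i E Var(F_t|z_−i) ≥ c > 0 at some fixed σ, t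
(full re-randomisation of the thermal
fluctuation by one sphere) kills the variance leg only: pivot by restating X_A for bounded smooth
G(F_t) (conditional-law response, which
absorbs the variance) or close `superseded` by whichever route delivers the variance half of
L2HydroFields. ¬HardCorePoincare (gap → 0 with
N for the canonical hard-core law at small packing) forces a restate to a weaker concentration
inequality for symmetric Lipschitz statistics.
L2HydroFields proved by any route moots the Assembly (cruxes keep independent interest as
fluctuation theorems).

NOT DECOMPOSED YET. The one-particle Green's-function statement itself (needs the linearised
hs-Euler system as a Lean object — definition request), the
Cauchy–Schwarz/chain-rule glue, the split of ResamplingInfluence into transported part + cascade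
noise, the PDE homotopy vs the
activity↔density inverse map inside PreShockHomotopy, the finite-N score identity and
uniform-integrability lemmas inside the Assembly
(provable now, filed by provers with --supports Assembly), any rate in N (Kn^(1/2) expected), d = 3
only.

CHEAPEST FALSIFIER. (i) Free flight (the BoltzmannHypothesis kernel): Cov(S_0, F_t) is explicit and
ballistic ≠ linearised Euler — confirms the cruxes are not
vacuous (they fail exactly where Euler fails); not a refutation at fixed σ > 0. (ii) MD at packing
0.05–0.1 (kit): tagged-sphere ensemble,
E[δρ(x,t) | x₀,v₀] must be a sound shell of radius ct plus a heat mode carrying the dressed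
(δN,δP,δE) with o(1/N) remainder, and
(N+1)·E|D₀F_t|² must DEcrease with N (slope ≈ −1/3 in log-log). (iii) HardCorePoincare for N+1 = 2,3
spheres on 𝕋³: explicit gap of the
resample-one-sphere chain vs σ (kit-computable); (iv) lookup: a canonical/hard-core version of
Bertini2002 Thm 2.2 in print
(Helmuth–Perkins–Petti 2022, Michelen–Perkins 2022+) would downgrade crux 4 to support/known.

NUMBERS. Fixed reduced density (N+1)ε³ = σ³; collisions per particle per unit macroscopic time ≍
(N+1)^(1/3) (Kn ≍ N^(-1/3)); Efron–Stein budget: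
transported part O(N^-2)·(N+1) = O(1/N), cascade noise O(N^-4/3)·(N+1) = O(N^-1/3); true Var(F_t) ≍
1/N. BCC (CE): zξ(β)/(1−2zξ) < 1 with
ξ = 4π/3 for unit exclusion radius ⇒ activity z < 1/(4π) ≈ 0.08, packing ≲ 0.04 (grand canonical,
Bertini2002 p5). Hard-sphere freezing
at packing ≈ 0.49 (irrelevant at σ < σ₀). Long-time tail of the velocity autocorrelation ∼ t^(-3/2)
in d = 3 (integrable; expected O(Kn)
correction). Items at open: 10 typed (1 target, 1 assembly, 3 cruxes, 5 support) + 1 informal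
support + 1 definition request.

DEFINITION REQUESTS. LinearizedHsEuler (topic Literature/Analysis/FluidPDE): the compressible Euler
system with p = hsPressure σ ρ θ linearised around a
classical solution on [0,T) × 𝕋³ in conservative variables, forward solution operator 𝒢_t on
distributions/measures and its adjoint
(backward) on smooth test fields, with the duality d/dκ⟨U_κ(t),χ⟩ = ⟨∂_κU_κ(0), 𝒢_t^*χ⟩ — needed to
type OneParticleGreenResponse and a
Spohn-(7.19) statement. No cite facts requested (Bertini2002 Thm 2.2 is grand-canonical and would
not discharge HardCorePoincare).

Novelty: Searches (2026-08-15): `lit search --hybrid "spectral gap Glauber dynamics continuous gas Poincaré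
inequality hard core"` (12 local rows,
none specific); `lit search --source crossref "spectral gap Glauber dynamics continuous gas"` (8:
doi:10.1016/s0246-0203(01)01085-8 = Bertini2002,
doi:10.1214/ejp.v18-2260, doi:10.1007/s00222-014-0518-z = GloriaNeukammOtto2014); `lit search
--source crossref "Duerinckx size of chaos
Glauber calculus"` (doi:10.1007/s00220-021-03978-3 = arXiv:1912.01366, READ pp.3–4, 7–8, 11, 18:
Glauber derivative w.r.t. iid initial data,
Lemma 1 Efron–Stein, Prop. 1 sensitivity, linearised Vlasov response); `lit search --source crossref
"Helmuth Perkins Petti correlation decay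
hard spheres"` (doi:10.1214/21-aap1728); `lit read doi:10.1016/s0246-0203(01)01085-8` (Thm 2.2 p5,
condition (CE)); inherited from the card:
lit read LastPenrose2017 Thms 4.1/18.7/19.1, Spohn1991 pp.86–89, lit frontier/bridges
AtomisticToContinuum; OpenAlex/S2/arXiv APIs
rate-limited today (logged). Nearest prior art found: Duerinckx2021 (arXiv:1912.01366) — Glauber
calculus on the initial data of a
deterministic Newtonian system in the MEAN-FIELD regime (t ≪ log N), with Efron–Stein, pathwise
O(1/N) sensitivity and linearised Vlasov
as the one-particle response; Bertini2002 Thm 2.2 / HelmuthPerkinsPetti2022 (static gap); Spohn1991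
§7.1 (the fluctuation conjecture the
cruxes instantiate); Lanford1975 / BGSSAnnals2023 (one-particle influence tracked pathwise,
Boltzmann–Grad only); Glor  [refs: 10.1016/s0246-0203(01, 10.1214/ejp.v18-2260, 10.1007/s00222-014-0518-z, 10.1007/s00220-021-03978-3, 10.1214/21-aap1728, 1912.01366, doi:10.1016/s0246-0203, doi:10.1214/ejp.v18-2260, doi:10.1007/s00222-014-0518-z, doi:10.1007/s00220-021-03978-3, doi:10.1214/21-aap1728, Bertini2002, GloriaNeukammOtto2014, LastPenrose2017, Spohn1991, Duerinckx2021, HelmuthPerkinsPetti2022, Lanford1975, BGSSAnnals2023]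

Barriers (technique_class: score-identity efron-stein glauber-calculus one-particle): - technique_class: score-identity efron-stein glauber-calculus one-particle
- Literature.Barriers.AtomisticToContinuum.BoltzmannHypothesisBarrier: not in its class (no entropy
method, no classification of stationary states of the infinite system); the closure input is
replaced by two one-particle response statements which visibly FAIL for the barrier's ideal-gas
kernel (free flight keeps ballistic memory of v₀, so Cov(S_0,F_t) is free transport, not linearised
Euler) — the cruxes carry the collisional content and nothing refuted is re-wanted; honest residue:
ScoreLinearResponse at κ = 0 is Spohn's open fluctuation statement; the bet is that a one-particle,
L², conditional-mean statement is the smallest carrier of local equilibrium.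
- Literature.Barriers.AtomisticToContinuum.NonAttractiveSystemsBarrier: a two-copy comparison is
used but NOT an order-preserving/monotone coupling — copies differ by one resampled sphere and are
compared only through E|ΔF_t|² of a macroscopic observable (Efron–Stein), so the
IsOrderPreservingOn/IsL1NonexpansiveOn equivalences (Temple, Crandall–Tartar) do not constrain it.
- Literature.Barriers.AtomisticToContinuum.NoDensityExpansionBarrier: evaded — σ fixed, no expansion
in density or in collision histories, no transport coefficient (Euler order); long-time tails enter
only as the integrable t^(-3/2) memory in why ScoreLinearResponse might fail.
- Literature.Barriers.AtomisticToContinuum.DiluteRegimeBarrier: evaded in form and substance — no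
Boltz

Novelty grade: new-combination — refuter route-review gen-1 (rreview-39f6b731), after the operator retired the route 13:45Z (not-a-thesis: Assembly 3077 concludes Literature…HydrodynamicLimit, never the route's own target 0800 — found independently: no filed item implies 0800; repair = glue cruxes+supports → L2HydroFields, Assembly (refuter refuter-rreview-route-AtomisticToContinu-39f6b731-0, 2026-08-15T13:51:54Z; prior: arXiv:1912.01366 (Duerinckx2021), doi:10.1016/s0246-0203(01)01085-8 (BCC2002), doi:10.1007/978-3-540-24587-2_68 (Kannan–Mahoney–Montenegro 2003), arXiv:1407.1930 (Hayes–Moore 2014), doi:10.1214/21-aap1728 (HPP2022), Spohn1991 §7.1)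

History (route lifecycle, newest last):
- 2026-08-15T13:45:06Z · CLOSED retired — not-a-thesis: assembly does not conclude the sub-problem Statement (operator:999:1257524)

sub-problem: HydrodynamicLimit · status: closed(retired) · opened planner-plancard-AtomisticToContinuum-Hydrody-4e99ef50-0 2026-08-15T11:10:52Z · rev 0 · ledger route-AtomisticToContinuum-OneParticleInfluence
GENERATED by the gate from the ledger (D-0016/17). Provers cite these decls: `theorem foo : Summit.AtomisticToContinuum.HydrodynamicLimit.Theses.OneParticleInfluence.<Decl> := …` in Summits/AtomisticToContinuum/HydrodynamicLimit/Theorems/<Name>.lean.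
-/

namespace Summit.AtomisticToContinuum.HydrodynamicLimit.Theses.OneParticleInfluence

open scoped BigOperators Topology Manifold Classical MeasureTheory ProbabilityTheory Matrix InnerProductSpace ComplexConjugate ContinuousMap
open Filter Set Function TopologicalSpace MeasureTheory

attribute [summit_statement] _root_.HydrodynamicLimit

/-- item stmt-AtomisticToContinuum-0800 · target · rank 0 · closed · moot by None · by planner
why it might fail: in substance the open conjunct itself (L² ⇔ in probability here by energy conservation); deterministic spheres at fixed σ may fail to keep local equilibrium on Euler times (Spohn1991 I.3).
sources: Spohn1991, OllaVaradhanYau1993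
[target] Mean-square hydrodynamic limit (typed shadow of one- and two-point cumulant control): for
all continuous profiles ∃ σ₀ ∀ σ<σ₀ ∀ classical hs-Euler solutions on [0,T) ∀ flows, if the local
Gibbs fields converge at t = 0 then for every t < T and continuous χ the lower integrals ∫⁻ |density
field(Φ_t z; χ) − ∫χρ_t|², ∫⁻ ‖momentum field − ∫χρ_t u_t‖², ∫⁻ |energy field − ∫χE_t|² against
localGibbsLaw σ a₀ u₀ θ₀ N tend to 0 in ℝ≥0∞ (lintegral: no Bochner junk). Stronger than
TendstoHydroFieldsAt (adds uniform integrability); delivered by 1-marginal → local Maxwellian in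
(1+|v|²)-weighted L¹ and 2-marginal → product. -/
@[route_item "route-AtomisticToContinuum-OneParticleInfluence"]
def L2HydroFields : Prop :=
  ∀ (a₀ θ₀ : Literature.MathematicalPhysics.KineticTheory.T3 → ℝ) (u₀ : Literature.MathematicalPhysics.KineticTheory.T3 → Literature.MathematicalPhysics.KineticTheory.V3), Continuous a₀ → Continuous θ₀ → Continuous u₀ → (∀ x, 0 < a₀ x) → (∀ x, 0 < θ₀ x) → ∃ σ₀ : ℝ, 0 < σ₀ ∧ ∀ σ : ℝ, 0 < σ → σ < σ₀ → ∀ (T : ℝ) (ρ θ : ℝ → Literature.MathematicalPhysics.KineticTheory.T3 → ℝ) (u : ℝ → Literature.MathematicalPhysics.KineticTheory.T3 → Literature.MathematicalPhysics.KineticTheory.V3), Literature.MathematicalPhysics.KineticTheory.IsHardSphereEulerSolution σ T ρ u θ → ∀ Φ : (N : ℕ) → Literature.Analysis.FluidPDE.HardSphereFlow (Literature.Analysis.FluidPDE.Torus.geometry (Fin 3)) (Literature.MathematicalPhysics.KineticTheory.hsDiameter σ N) (N + 1), Literature.MathematicalPhysics.KineticTheory.TendstoHydroFieldsAt (fun N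 => Literature.MathematicalPhysics.KineticTheory.localGibbsLaw σ a₀ u₀ θ₀ N (Φ N)) Φ ρ u θ 0 → ∀ t ∈ Set.Ico 0 T, ∀ χ : Literature.MathematicalPhysics.KineticTheory.T3 → ℝ, Continuous χ → Filter.Tendsto (fun N : ℕ => ∫⁻ z, ENNReal.ofReal (|Literature.MathematicalPhysics.KineticTheory.empiricalDensityField ((Φ N).flow t z) χ - ∫ x, χ x * ρ t x| ^ 2) ∂(Literature.MathematicalPhysics.KineticTheory.localGibbsLaw σ a₀ u₀ θ₀ N (Φ N))) Filter.atTop (nhds 0) ∧ Filter.Tendsto (fun N : ℕ => ∫⁻ z, ENNReal.ofReal (‖Literature.MathematicalPhysics.KineticTheory.empiricalMomentumField ((Φ N).flow t z) χ - ∫ x, (χ x * ρ t x) • u t x‖ ^ 2) ∂(Literature.MathematicalPhysics.KineticTheory.localGibbsLaw σ a₀ u₀ θ₀ N (Φ N))) Filter.atTop (nhds 0) ∧ Filter.Tendsto (fun N : ℕ => ∫⁻ z, ENNReal.ofReal (|Literature.MathematicalPhysics.KineticTheory.empiricalEnergyField ((Φ N).flow t z) χ - ∫ x, χ x * Literature.MathematicalPhysics.KineticTheory.totalEnergyDensity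 (ρ t x) (u t x) (θ t x)| ^ 2) ∂(Literature.MathematicalPhysics.KineticTheory.localGibbsLaw σ a₀ u₀ θ₀ N (Φ N))) Filter.atTop (nhds 0)

/-- item stmt-AtomisticToContinuum-3070 · crux · rank 2 · closed · moot by None · by planner
why it might fail: Open even at global equilibrium (Spohn1991 (7.19): Euler-scale time correlations unproved for deterministic models except hard rods); an O(1) non-hydrodynamic memory of the tagged sphere surviving N^(1/3) collision times (kinetic/ring modes) adds a non-Euler term.
sources: Spohn1991, Duerinckx2021, LastPenrose2017, arXiv:1912.01366, EvansMorriss2008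
[crux] SCORE LINEAR RESPONSE (card crux 1, integrated/dressed form): for the target profile
(a₁,u₁,θ₁), every Λ ≥ 1 and σ < σ₀(a₁,u₁,θ₁,Λ): along any smooth path κ ∈ [0,1] of profiles
(a_κ,u₀κ,θ₀κ) with constant start, endpoint (a₁,u₁,θ₁) and activities in the Λ-hull of a₁, and any
jointly smooth family of classical hs-Euler solutions U_κ on [0,T) whose data are the LLN fields of
the κ-profiles, for t < T and continuous χ: Cov_{p_κ^N}(S_κ, ⟨U_N(t),χ⟩) → ∂_κ⟨U_κ(t),χ⟩ UNIFORMLY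
in κ ∈ [0,1] (density, momentum components, energy), where S_κ(z) = Σ_i ∂_κ log
localGibbsProfile(a_κ,u₀κ,θ₀κ)(z_i) is the score of the local Gibbs family. Exact score identity:
Cov_κ(S_κ,F) = d/dκ E_κ F; exchangeability: = (N+1)·Cov_κ(s_κ(z₀), E_κ[F_t|z₀]) — the conditional
mean response m_t(z₀) = E[F_t|z₀] − E F_t of the fluid to ONE tagged sphere, whose intended
identification (layer 2) is m_t = 𝒢^κ_t[m_0] + o(1/N) in L² (linearised hs-Euler transport of the
DRESSED static imprint; sound shell + entropy mode). κ = 0 case = EquilibriumLinearResponse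
(Spohn1991 (7.19) in response form); t = 0 case = StaticScoreResponse. [difficulty: open-problem] -/
@[route_item "route-AtomisticToContinuum-OneParticleInfluence"]
def ScoreLinearResponse : Prop :=
  ∀ (a₁ θ₁ : Literature.MathematicalPhysics.KineticTheory.T3 → ℝ) (u₁ : Literature.MathematicalPhysics.KineticTheory.T3 → Literature.MathematicalPhysics.KineticTheory.V3), Continuous a₁ → Continuous θ₁ → Continuous u₁ → (∀ x, 0 < a₁ x) → (∀ x, 0 < θ₁ x) → ∀ Λ : ℝ, 1 ≤ Λ → ∃ σ₀ : ℝ, 0 < σ₀ ∧ ∀ σ : ℝ, 0 < σ → σ < σ₀ → ∀ (a θ₀ : ℝ → Literature.MathematicalPhysics.KineticTheory.T3 → ℝ) (u₀ : ℝ → Literature.MathematicalPhysics.KineticTheory.T3 → Literature.MathematicalPhysics.KineticTheory.V3), Literature.Analysis.FunctionSpaces.Torus.IsSmoothSpaceTimeOn (Set.Icc 0 1) a → Literature.Analysis.FunctionSpaces.Torus.IsSmoothSpaceTimeOn (Set.Icc 0 1) θ₀ → Literature.Analysis.FunctionSpaces.Torus.IsSmoothSpaceTimeOn (Set.Icc 0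 1) u₀ → (∀ κ ∈ Set.Icc (0 : ℝ) 1, ∀ x, Λ⁻¹ * (⨅ y, a₁ y) ≤ a κ x ∧ a κ x ≤ Λ * (⨆ y, a₁ y) ∧ 0 < θ₀ κ x) → (∀ x, a 0 x = a 0 0 ∧ θ₀ 0 x = θ₀ 0 0 ∧ u₀ 0 x = u₀ 0 0) → a 1 = a₁ → θ₀ 1 = θ₁ → u₀ 1 = u₁ → ∀ (T : ℝ) (ρ θ : ℝ → ℝ → Literature.MathematicalPhysics.KineticTheory.T3 → ℝ) (u : ℝ → ℝ → Literature.MathematicalPhysics.KineticTheory.T3 → Literature.MathematicalPhysics.KineticTheory.V3), (∀ κ ∈ Set.Icc (0 : ℝ) 1, Literature.MathematicalPhysics.KineticTheory.IsHardSphereEulerSolution σ T (ρ κ) (u κ) (θ κ)) → ContDiffOn ℝ ((⊤ : ℕ∞) : WithTop ℕ∞) (fun q : ℝ × ℝ × EuclideanSpace ℝ (Fin 3) => ρ q.1 q.2.1 (Literature.Analysis.FunctionSpaces.Torus.proj q.2.2)) (Set.Icc 0 1 ×ˢ (Set.Ico 0 T ×ˢ Set.univ)) → ContDiffOn ℝ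 ((⊤ : ℕ∞) : WithTop ℕ∞) (fun q : ℝ × ℝ × EuclideanSpace ℝ (Fin 3) => u q.1 q.2.1 (Literature.Analysis.FunctionSpaces.Torus.proj q.2.2)) (Set.Icc 0 1 ×ˢ (Set.Ico 0 T ×ˢ Set.univ)) → ContDiffOn ℝ ((⊤ : ℕ∞) : WithTop ℕ∞) (fun q : ℝ × ℝ × EuclideanSpace ℝ (Fin 3) => θ q.1 q.2.1 (Literature.Analysis.FunctionSpaces.Torus.proj q.2.2)) (Set.Icc 0 1 ×ˢ (Set.Ico 0 T ×ˢ Set.univ)) → ∀ Φ : (N : ℕ) → Literature.Analysis.FluidPDE.HardSphereFlow (Literature.Analysis.FluidPDE.Torus.geometry (Fin 3)) (Literature.MathematicalPhysics.KineticTheory.hsDiameter σ N) (N + 1), (∀ κ ∈ Set.Icc (0 : ℝ) 1, Literature.MathematicalPhysics.KineticTheory.TendstoHydroFieldsAt (fun N => Literature.MathematicalPhysics.KineticTheory.localGibbsLaw σ (a κ) (u₀ κ) (θ₀ κ) N (Φ N)) Φ (ρ κ) (u κ) (θ κ) 0) → ∀ t ∈ Set.Ico 0 T, ∀ χ : Literature.MathematicalPhysics.KineticTheory.T3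 → ℝ, Continuous χ → let p : ℝ → (N : ℕ) → MeasureTheory.Measure (Literature.Analysis.FluidPDE.Config (N + 1) (Fin 3) Literature.MathematicalPhysics.KineticTheory.T3) := fun κ N => Literature.MathematicalPhysics.KineticTheory.localGibbsLaw σ (a κ) (u₀ κ) (θ₀ κ) N (Φ N); let S : ℝ → (N : ℕ) → Literature.Analysis.FluidPDE.Config (N + 1) (Fin 3) Literature.MathematicalPhysics.KineticTheory.T3 → ℝ := fun κ N z => ∑ i, derivWithin (fun κ' => Real.log (Literature.MathematicalPhysics.KineticTheory.localGibbsProfile (a κ') (u₀ κ') (θ₀ κ') (z i))) (Set.Icc 0 1) κ; TendstoUniformlyOn (fun N κ => ProbabilityTheory.covariance (S κ N) (fun z => Literature.MathematicalPhysics.KineticTheory.empiricalDensityField ((Φ N).flow t z) χ) (p κ N)) (fun κ => derivWithin (fun κ' => ∫ x, χ x * ρ κ' t x) (Set.Icc 0 1) κ) Filter.atTop (Set.Icc 0 1) ∧ (∀ j : Fin 3, TendstoUniformlyOn (fun N κ => ProbabilityTheory.covariance (S κ N) (fun z => Literature.MathematicalPhysics.KineticTheory.empiricalMomentumField ((Φ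 N).flow t z) χ j) (p κ N)) (fun κ => derivWithin (fun κ' => ∫ x, χ x * ρ κ' t x * u κ' t x j) (Set.Icc 0 1) κ) Filter.atTop (Set.Icc 0 1)) ∧ TendstoUniformlyOn (fun N κ => ProbabilityTheory.covariance (S κ N) (fun z => Literature.MathematicalPhysics.KineticTheory.empiricalEnergyField ((Φ N).flow t z) χ) (p κ N)) (fun κ => derivWithin (fun κ' => ∫ x, χ x * Literature.MathematicalPhysics.KineticTheory.totalEnergyDensity (ρ κ' t x) (u κ' t x) (θ κ' t x)) (Set.Icc 0 1) κ) Filter.atTop (Set.Icc 0 1)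

/-- item stmt-AtomisticToContinuum-3071 · crux · rank 3 · closed · moot by None · by planner
why it might fail: If Euler-scale fluctuation fields are NOT deterministically transported (failure of Spohn1991 (7.13) for hard spheres) the cascade re-randomises the whole O(N^-1/2) fluctuation and the sum stays O(1): crux false, conjunct untouched (superconcentration/chaos regime).
sources: Spohn1991, Duerinckx2021, EfronStein1981, Chatterjee2016
[crux] ONE-PARTICLE RESAMPLING INFLUENCE (card crux 2): for the target local Gibbs law p_N, a
pre-shock classical solution matching the data, t < T and continuous χ: Σ_i E_p[Var_p(F_t | z_{−i})]
→ 0 for F_t = ⟨U_N(t),χ⟩ (density, momentum components, energy) — resampling ONE sphere's initial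
state from its conditional law given the others moves the time-t macroscopic field by o(N^{-1/2}) in
L² (by exchangeability the sum is (N+1)·E Var(F_t|z_{−0}) = (N+1)·E|D₀F_t|²). Two-copy comparison in
L² of a macroscopic observable only, never pathwise. Fluctuating-hydrodynamics bookkeeping:
transported fluctuation changes by O(1/N), cascade-re-randomised noise has Euler-scale size
N^{-1/2}Kn^{1/2} = N^{-2/3}, so the sum is ~ N^{-1/3} → 0. Mean-field analogue Duerinckx2021 Prop. 1
(O(1/N) by Grönwall), unavailable here. [difficulty: open-problem] -/
@[route_item "route-AtomisticToContinuum-OneParticleInfluence"]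
def ResamplingInfluence : Prop :=
  ∀ (a₁ θ₁ : Literature.MathematicalPhysics.KineticTheory.T3 → ℝ) (u₁ : Literature.MathematicalPhysics.KineticTheory.T3 → Literature.MathematicalPhysics.KineticTheory.V3), Continuous a₁ → Continuous θ₁ → Continuous u₁ → (∀ x, 0 < a₁ x) → (∀ x, 0 < θ₁ x) → ∃ σ₀ : ℝ, 0 < σ₀ ∧ ∀ σ : ℝ, 0 < σ → σ < σ₀ → ∀ (T : ℝ) (ρ θ : ℝ → Literature.MathematicalPhysics.KineticTheory.T3 → ℝ) (u : ℝ → Literature.MathematicalPhysics.KineticTheory.T3 → Literature.MathematicalPhysics.KineticTheory.V3), Literature.MathematicalPhysics.KineticTheory.IsHardSphereEulerSolution σ T ρ u θ → ∀ Φ : (N : ℕ) → Literature.Analysis.FluidPDE.HardSphereFlow (Literature.Analysis.FluidPDE.Torus.geometry (Fin 3)) (Literature.MathematicalPhysics.KineticTheory.hsDiameter σ N) (N + 1), Literature.MathematicalPhysics.KineticTheory.TendstoHydroFieldsAt (fun N => Literature.MathematicalPhysics.KineticTheory.localGibbsLaw σ a₁ u₁ θ₁ N (Φ N)) Φ ρ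 u θ 0 → ∀ t ∈ Set.Ico 0 T, ∀ χ : Literature.MathematicalPhysics.KineticTheory.T3 → ℝ, Continuous χ → let p : (N : ℕ) → MeasureTheory.Measure (Literature.Analysis.FluidPDE.Config (N + 1) (Fin 3) Literature.MathematicalPhysics.KineticTheory.T3) := fun N => Literature.MathematicalPhysics.KineticTheory.localGibbsLaw σ a₁ u₁ θ₁ N (Φ N); let m : (N : ℕ) → Fin (N + 1) → MeasurableSpace (Literature.Analysis.FluidPDE.Config (N + 1) (Fin 3) Literature.MathematicalPhysics.KineticTheory.T3) := fun N i => MeasurableSpace.comap (fun (z : Literature.Analysis.FluidPDE.Config (N + 1) (Fin 3) Literature.MathematicalPhysics.KineticTheory.T3) (j : Fin N) => z (i.succAbove j)) MeasurableSpace.pi; Filter.Tendsto (fun N : ℕ => ∑ i : Fin (N + 1), ∫ z, ProbabilityTheory.condVar (m N i) (fun z => Literature.MathematicalPhysics.KineticTheory.empiricalDensityField ((Φ N).flow t z) χ) (p N) z ∂(p N)) Filter.atTop (nhds 0) ∧ (∀ j : Fin 3, Filter.Tendsto (fun N : ℕ => ∑ i : Fin (N + 1), ∫ z, ProbabilityTheory.condVar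 (m N i) (fun z => Literature.MathematicalPhysics.KineticTheory.empiricalMomentumField ((Φ N).flow t z) χ j) (p N) z ∂(p N)) Filter.atTop (nhds 0)) ∧ Filter.Tendsto (fun N : ℕ => ∑ i : Fin (N + 1), ∫ z, ProbabilityTheory.condVar (m N i) (fun z => Literature.MathematicalPhysics.KineticTheory.empiricalEnergyField ((Φ N).flow t z) χ) (p N) z ∂(p N)) Filter.atTop (nhds 0)

/-- item stmt-AtomisticToContinuum-3072 · crux · rank 4 · closed · moot by None · by planner
why it might fail: Hard core is the ϕ=+∞ limit of BCC's potentials and the ensemble is CANONICAL with inhomogeneous activity: the fixed-N constraint couples all spheres at O(1/N), summed over N+1 resamplings this is O(1) — exactly borderline for a uniform constant.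
sources: Bertini2002, HelmuthPerkinsPetti2022, EfronStein1981, doi:10.1016/s0246-0203(01)01085-8, doi:10.1214/21-aap1728
[crux] CANONICAL HARD-CORE POINCARÉ / EFRON–STEIN (card crux 3): for continuous a₁ > 0 (and any θ₁ >
0, u₁ — velocities are conditionally independent Maxwellians) there is σ₀ such that for σ < σ₀ the
canonical local Gibbs law p_N of N+1 spheres of diameter σ(N+1)^(-1/3) on 𝕋³ satisfies Var_p(F) ≤ C
Σ_i E_p[Var_p(F | z_{−i})] for all F ∈ L²(p_N), C uniform in N (and in the flow label): a uniform
spectral gap of the heat-bath "resample one sphere" Glauber dynamics of the CANONICAL inhomogeneous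
hard-core gas at small packing fraction. Products: C = 1 (EfronStein1981, Duerinckx2021 Lemma 1);
grand-canonical finite-range ϕ ≥ 0 under (CE) zξ/(1−2zξ) < 1: Bertini2002 Thm 2.2 p5, uniform in
volume and boundary condition; low-fugacity hard spheres: HelmuthPerkinsPetti2022. Only the target
profile (κ = 1) is used by the Assembly. [difficulty: L] -/
@[route_item "route-AtomisticToContinuum-OneParticleInfluence"]
def HardCorePoincare : Prop :=
  ∀ (a₁ θ₁ : Literature.MathematicalPhysics.KineticTheory.T3 → ℝ) (u₁ : Literature.MathematicalPhysics.KineticTheory.T3 → Literature.MathematicalPhysics.KineticTheory.V3), Continuous a₁ → Continuous θ₁ → Continuous u₁ → (∀ x, 0 < a₁ x) → (∀ x, 0 < θ₁ x) → ∃ σ₀ : ℝ, 0 < σ₀ ∧ ∀ σ : ℝ, 0 < σ → σ < σ₀ → ∃ C : ℝ, 0 < C ∧ ∀ (N : ℕ) (Φ : Literature.Analysis.FluidPDE.HardSphereFlow (Literature.Analysis.FluidPDE.Torus.geometry (Fin 3)) (Literature.MathematicalPhysics.KineticTheory.hsDiameter σ N) (N + 1)) (F : Literature.Analysis.FluidPDE.Config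 (N + 1) (Fin 3) Literature.MathematicalPhysics.KineticTheory.T3 → ℝ), MeasureTheory.MemLp F 2 (Literature.MathematicalPhysics.KineticTheory.localGibbsLaw σ a₁ u₁ θ₁ N Φ) → ProbabilityTheory.variance F (Literature.MathematicalPhysics.KineticTheory.localGibbsLaw σ a₁ u₁ θ₁ N Φ) ≤ C * ∑ i : Fin (N + 1), ∫ z, ProbabilityTheory.condVar (MeasurableSpace.comap (fun (z : Literature.Analysis.FluidPDE.Config (N + 1) (Fin 3) Literature.MathematicalPhysics.KineticTheory.T3) (j : Fin N) => z (i.succAbove j)) MeasurableSpace.pi) F (Literature.MathematicalPhysics.KineticTheory.localGibbsLaw σ a₁ u₁ θ₁ N Φ) z ∂(Literature.MathematicalPhysics.KineticTheory.localGibbsLaw σ a₁ u₁ θ₁ N Φ)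

/-- item stmt-AtomisticToContinuum-3073 · support · rank 9 · closed · moot by None · by planner
sources: GST2013, CIP1994, Alexander1975
[support] the canonical law with CONSTANT profiles (c, ū, θ̄) is invariant under every hard-sphere
flow, lawAt Φ p t = p: its density 1_D Π_i M_{ū,θ̄}(v_i)/Z is a function of kinetic energy and total
momentum; Liouville preservation (HardSphereFlow.measurePreserving), energy conservation
(IsHardSphereTrajectory.configEnergy_eq_holds), momentum conservation (configMomentum_freeFlight /
configMomentum_collidePair along isTrajectory), invariance of the good set. Gives E_{p_0}[F_t] =
E_{p_0}[F_0] at the κ = 0 end of the homotopy; rests on PROVED cone facts. [difficulty: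
provable-now] -/
@[route_item "route-AtomisticToContinuum-OneParticleInfluence"]
def HomogeneousInvariance : Prop :=
  ∀ (σ c θc : ℝ) (uc : Literature.MathematicalPhysics.KineticTheory.V3), 0 < σ → 0 < c → 0 < θc → ∀ (N : ℕ) (Φ : Literature.Analysis.FluidPDE.HardSphereFlow (Literature.Analysis.FluidPDE.Torus.geometry (Fin 3)) (Literature.MathematicalPhysics.KineticTheory.hsDiameter σ N) (N + 1)) (t : ℝ), Φ.lawAt (Literature.MathematicalPhysics.KineticTheory.localGibbsLaw σ (fun _ => c) (fun _ => uc) (fun _ => θc) N Φ) t = Literature.MathematicalPhysics.KineticTheory.localGibbsLaw σ (fun _ => c) (fun _ => uc) (fun _ => θc) N Φ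

/-- item stmt-AtomisticToContinuum-3074 · support · rank 9 · closed · moot by None · by planner
sources: Ruelle1969, LebowitzPenrose1964, HelmuthPerkinsPetti2022
[support] t = 0 case of ScoreLinearResponse (equilibrium statistical mechanics only, no flow): along
a smooth profile path with activities in the Λ-hull of a₁, if ρ₀(κ,·) are the LLN density profiles
(hypothesis), then Cov_{p_κ^N}(S_κ, ⟨U_N(0),χ⟩) → ∂_κ ∫χ·(ρ₀, ρ₀u₀, ρ₀(|u₀|²/2 + 3θ₀/2))_κ uniformly
in κ: differentiability of the canonical one-point density in the activity profile, uniformly in N,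
at small packing fraction (cluster expansion; canonical corrections O(1/N) summed against the
score); velocity parts are Gaussian computations. [difficulty: M] -/
@[route_item "route-AtomisticToContinuum-OneParticleInfluence"]
def StaticScoreResponse : Prop :=
  ∀ (a₁ θ₁ : Literature.MathematicalPhysics.KineticTheory.T3 → ℝ) (u₁ : Literature.MathematicalPhysics.KineticTheory.T3 → Literature.MathematicalPhysics.KineticTheory.V3), Continuous a₁ → Continuous θ₁ → Continuous u₁ → (∀ x, 0 < a₁ x) → (∀ x, 0 < θ₁ x) → ∀ Λ : ℝ, 1 ≤ Λ → ∃ σ₀ : ℝ, 0 < σ₀ ∧ ∀ σ : ℝ, 0 < σ → σ < σ₀ → ∀ (a θ₀ : ℝ → Literature.MathematicalPhysics.KineticTheory.T3 → ℝ) (u₀ : ℝ → Literature.MathematicalPhysics.KineticTheory.T3 → Literature.MathematicalPhysics.KineticTheory.V3), Literature.Analysis.FunctionSpaces.Torus.IsSmoothSpaceTimeOn (Set.Icc 0 1) a → Literature.Analysis.FunctionSpaces.Torus.IsSmoothSpaceTimeOn (Set.Icc 0 1) θ₀ → Literature.Analysis.FunctionSpaces.Torus.IsSmoothSpaceTimeOn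 (Set.Icc 0 1) u₀ → (∀ κ ∈ Set.Icc (0 : ℝ) 1, ∀ x, Λ⁻¹ * (⨅ y, a₁ y) ≤ a κ x ∧ a κ x ≤ Λ * (⨆ y, a₁ y) ∧ 0 < θ₀ κ x) → ∀ ρ₀ : ℝ → Literature.MathematicalPhysics.KineticTheory.T3 → ℝ, Literature.Analysis.FunctionSpaces.Torus.IsSmoothSpaceTimeOn (Set.Icc 0 1) ρ₀ → ∀ Φ : (N : ℕ) → Literature.Analysis.FluidPDE.HardSphereFlow (Literature.Analysis.FluidPDE.Torus.geometry (Fin 3)) (Literature.MathematicalPhysics.KineticTheory.hsDiameter σ N) (N + 1), (∀ κ ∈ Set.Icc (0 : ℝ) 1, Literature.MathematicalPhysics.KineticTheory.TendstoHydroFieldsAt (fun N => Literature.MathematicalPhysics.KineticTheory.localGibbsLaw σ (a κ) (u₀ κ) (θ₀ κ) N (Φ N)) Φ (fun _ => ρ₀ κ) (fun _ => u₀ κ) (fun _ => θ₀ κ) 0) → ∀ χ : Literature.MathematicalPhysics.KineticTheory.T3 → ℝ, Continuous χ → let p : ℝ → (N : ℕ) → MeasureTheory.Measure (Literature.Analysis.FluidPDE.Config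 (N + 1) (Fin 3) Literature.MathematicalPhysics.KineticTheory.T3) := fun κ N => Literature.MathematicalPhysics.KineticTheory.localGibbsLaw σ (a κ) (u₀ κ) (θ₀ κ) N (Φ N); let S : ℝ → (N : ℕ) → Literature.Analysis.FluidPDE.Config (N + 1) (Fin 3) Literature.MathematicalPhysics.KineticTheory.T3 → ℝ := fun κ N z => ∑ i, derivWithin (fun κ' => Real.log (Literature.MathematicalPhysics.KineticTheory.localGibbsProfile (a κ') (u₀ κ') (θ₀ κ') (z i))) (Set.Icc 0 1) κ; TendstoUniformlyOn (fun N κ => ProbabilityTheory.covariance (S κ N) (fun z => Literature.MathematicalPhysics.KineticTheory.empiricalDensityField z χ) (p κ N)) (fun κ => derivWithin (fun κ' => ∫ x, χ x * ρ₀ κ' x) (Set.Icc 0 1) κ) Filter.atTop (Set.Icc 0 1) ∧ (∀ j : Fin 3, TendstoUniformlyOn (fun N κ => ProbabilityTheory.covariance (S κ N) (fun z => Literature.MathematicalPhysics.KineticTheory.empiricalMomentumField z χ j) (p κ N)) (fun κ => derivWithin (fun κ' => ∫ x, χ x * ρ₀ κ' x * u₀ κ' x j) (Set.Icc 0 1)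 κ) Filter.atTop (Set.Icc 0 1)) ∧ TendstoUniformlyOn (fun N κ => ProbabilityTheory.covariance (S κ N) (fun z => Literature.MathematicalPhysics.KineticTheory.empiricalEnergyField z χ) (p κ N)) (fun κ => derivWithin (fun κ' => ∫ x, χ x * Literature.MathematicalPhysics.KineticTheory.totalEnergyDensity (ρ₀ κ' x) (u₀ κ' x) (θ₀ κ' x)) (Set.Icc 0 1) κ) Filter.atTop (Set.Icc 0 1)

/-- item stmt-AtomisticToContinuum-3075 · support · rank 9 · closed · moot by None · by planner
sources: Spohn1991, EvansMorriss2008, Resibois1978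
[support] GLOBAL-EQUILIBRIUM special case (κ = 0) of ScoreLinearResponse: same hypotheses,
conclusion only at κ = 0 where p_0 is the homogeneous canonical Gibbs law: Cov_eq(Σ_i s_0(z_i),
⟨U_N(t),χ⟩) → ∂_κ|_0 ⟨U_κ(t),χ⟩ = linearised hs-Euler about the constant state applied to the
initial perturbation. This is the LINEAR-RESPONSE form of Spohn1991 Part II §7.1 (7.19) /
Landau–Placzek: Euler-scale equilibrium time correlations of the conserved fields of hard spheres
are transported by linearised Euler (sound modes, entropy/shear modes) — open for every
deterministic model except hard rods; first foothold for provers, MD check for refuters.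
[difficulty: open-problem] -/
@[route_item "route-AtomisticToContinuum-OneParticleInfluence"]
def EquilibriumLinearResponse : Prop :=
  ∀ (a₁ θ₁ : Literature.MathematicalPhysics.KineticTheory.T3 → ℝ) (u₁ : Literature.MathematicalPhysics.KineticTheory.T3 → Literature.MathematicalPhysics.KineticTheory.V3), Continuous a₁ → Continuous θ₁ → Continuous u₁ → (∀ x, 0 < a₁ x) → (∀ x, 0 < θ₁ x) → ∀ Λ : ℝ, 1 ≤ Λ → ∃ σ₀ : ℝ, 0 < σ₀ ∧ ∀ σ : ℝ, 0 < σ → σ < σ₀ → ∀ (a θ₀ : ℝ → Literature.MathematicalPhysics.KineticTheory.T3 → ℝ) (u₀ : ℝ → Literature.MathematicalPhysics.KineticTheory.T3 → Literature.MathematicalPhysics.KineticTheory.V3), Literature.Analysis.FunctionSpaces.Torus.IsSmoothSpaceTimeOn (Set.Icc 0 1) a → Literature.Analysis.FunctionSpaces.Torus.IsSmoothSpaceTimeOn (Set.Icc 0 1) θ₀ → Literature.Analysis.FunctionSpaces.Torus.IsSmoothSpaceTimeOn (Set.Icc 0 1) u₀ → (∀ κ ∈ Set.Icc (0 : ℝ)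 1, ∀ x, Λ⁻¹ * (⨅ y, a₁ y) ≤ a κ x ∧ a κ x ≤ Λ * (⨆ y, a₁ y) ∧ 0 < θ₀ κ x) → (∀ x, a 0 x = a 0 0 ∧ θ₀ 0 x = θ₀ 0 0 ∧ u₀ 0 x = u₀ 0 0) → a 1 = a₁ → θ₀ 1 = θ₁ → u₀ 1 = u₁ → ∀ (T : ℝ) (ρ θ : ℝ → ℝ → Literature.MathematicalPhysics.KineticTheory.T3 → ℝ) (u : ℝ → ℝ → Literature.MathematicalPhysics.KineticTheory.T3 → Literature.MathematicalPhysics.KineticTheory.V3), (∀ κ ∈ Set.Icc (0 : ℝ) 1, Literature.MathematicalPhysics.KineticTheory.IsHardSphereEulerSolution σ T (ρ κ) (u κ) (θ κ)) → ContDiffOn ℝ ((⊤ : ℕ∞) : WithTop ℕ∞) (fun q : ℝ × ℝ × EuclideanSpace ℝ (Fin 3) => ρ q.1 q.2.1 (Literature.Analysis.FunctionSpaces.Torus.proj q.2.2)) (Set.Icc 0 1 ×ˢ (Set.Ico 0 T ×ˢ Set.univ)) → ContDiffOn ℝ ((⊤ : ℕ∞) : WithTop ℕ∞) (fun q : ℝ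 × ℝ × EuclideanSpace ℝ (Fin 3) => u q.1 q.2.1 (Literature.Analysis.FunctionSpaces.Torus.proj q.2.2)) (Set.Icc 0 1 ×ˢ (Set.Ico 0 T ×ˢ Set.univ)) → ContDiffOn ℝ ((⊤ : ℕ∞) : WithTop ℕ∞) (fun q : ℝ × ℝ × EuclideanSpace ℝ (Fin 3) => θ q.1 q.2.1 (Literature.Analysis.FunctionSpaces.Torus.proj q.2.2)) (Set.Icc 0 1 ×ˢ (Set.Ico 0 T ×ˢ Set.univ)) → ∀ Φ : (N : ℕ) → Literature.Analysis.FluidPDE.HardSphereFlow (Literature.Analysis.FluidPDE.Torus.geometry (Fin 3)) (Literature.MathematicalPhysics.KineticTheory.hsDiameter σ N) (N + 1), (∀ κ ∈ Set.Icc (0 : ℝ) 1, Literature.MathematicalPhysics.KineticTheory.TendstoHydroFieldsAt (fun N => Literature.MathematicalPhysics.KineticTheory.localGibbsLaw σ (a κ) (u₀ κ) (θ₀ κ) N (Φ N)) Φ (ρ κ) (u κ) (θ κ) 0) → ∀ t ∈ Set.Ico 0 T, ∀ χ : Literature.MathematicalPhysics.KineticTheory.T3 → ℝ, Continuous χ →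 let p : ℝ → (N : ℕ) → MeasureTheory.Measure (Literature.Analysis.FluidPDE.Config (N + 1) (Fin 3) Literature.MathematicalPhysics.KineticTheory.T3) := fun κ N => Literature.MathematicalPhysics.KineticTheory.localGibbsLaw σ (a κ) (u₀ κ) (θ₀ κ) N (Φ N); let S : ℝ → (N : ℕ) → Literature.Analysis.FluidPDE.Config (N + 1) (Fin 3) Literature.MathematicalPhysics.KineticTheory.T3 → ℝ := fun κ N z => ∑ i, derivWithin (fun κ' => Real.log (Literature.MathematicalPhysics.KineticTheory.localGibbsProfile (a κ') (u₀ κ') (θ₀ κ') (z i))) (Set.Icc 0 1) κ; Filter.Tendsto (fun N : ℕ => ProbabilityTheory.covariance (S 0 N) (fun z => Literature.MathematicalPhysics.KineticTheory.empiricalDensityField ((Φ N).flow t z) χ) (p 0 N)) Filter.atTop (nhds (derivWithin (fun κ' => ∫ x, χ x * ρ κ' t x) (Set.Icc 0 1) 0)) ∧ (∀ j : Fin 3, Filter.Tendsto (fun N : ℕ => ProbabilityTheory.covariance (S 0 N) (fun z => Literature.MathematicalPhysics.KineticTheory.empiricalMomentumField ((Φ N).flow t z) χ j) (p 0 N)) Filter.atTop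 (nhds (derivWithin (fun κ' => ∫ x, χ x * ρ κ' t x * u κ' t x j) (Set.Icc 0 1) 0))) ∧ Filter.Tendsto (fun N : ℕ => ProbabilityTheory.covariance (S 0 N) (fun z => Literature.MathematicalPhysics.KineticTheory.empiricalEnergyField ((Φ N).flow t z) χ) (p 0 N)) Filter.atTop (nhds (derivWithin (fun κ' => ∫ x, χ x * Literature.MathematicalPhysics.KineticTheory.totalEnergyDensity (ρ κ' t x) (u κ' t x) (θ κ' t x)) (Set.Icc 0 1) 0))

/-- item stmt-AtomisticToContinuum-3076 · support · rank 9 · closed · moot by None · by planner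
sources: Majda1984, Sideris1985, Ruelle1969, LebowitzPenrose1964
[support] PRE-SHOCK HOMOTOPY WITH LOCAL-GIBBS MATCHING (card crux 4 + statics): for the target
profile there are Λ ≥ 1 and σ₀ such that for σ < σ₀, every classical hs-Euler solution (ρ,u,θ) on
[0,T) whose data are the LLN fields of (a₁,u₁,θ₁), every family of flows and every t < T, there is
T' > t and a smooth path κ ↦ (a_κ,u₀κ,θ₀κ) from constants to (a₁,u₁,θ₁) with activities in the
Λ-hull of a₁, plus a jointly smooth family of classical solutions on [0,T') with κ=1 member (ρ,u,θ),
constant κ=0 member, data = LLN fields of the κ-profiles, all laws probability measures (the exact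
hypothesis list of ScoreLinearResponse). Splits into (i) PDE: smooth dependence on data and
lower-semicontinuous life span for the symmetrisable hyperbolic hs-Euler system (Kato 1975,
Majda1984 Thm 2.1, HsEosLowDensity 0768), a path dodging earlier shocks (amplitude reduction toward
the mean state; the scaling (ρ,λu,λ²θ)(λt) multiplies the life span by 1/λ); (ii) statics: activity
↦ LLN density is a smooth local diffeomorphism with hull control at small packing (cluster expansion
+ implicit function theorem; LocalGibbsConcentration 0767). Why it might fail: life span is not
monotone along naive linear inte -/
@[route_item "route-AtomisticToContinuum-OneParticleInfluence"]
def PreShockHomotopy : Prop :=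
  ∀ (a₁ θ₁ : Literature.MathematicalPhysics.KineticTheory.T3 → ℝ) (u₁ : Literature.MathematicalPhysics.KineticTheory.T3 → Literature.MathematicalPhysics.KineticTheory.V3), Continuous a₁ → Continuous θ₁ → Continuous u₁ → (∀ x, 0 < a₁ x) → (∀ x, 0 < θ₁ x) → ∃ Λ : ℝ, 1 ≤ Λ ∧ ∃ σ₀ : ℝ, 0 < σ₀ ∧ ∀ σ : ℝ, 0 < σ → σ < σ₀ → ∀ (T : ℝ) (ρ θ : ℝ → Literature.MathematicalPhysics.KineticTheory.T3 → ℝ) (u : ℝ → Literature.MathematicalPhysics.KineticTheory.T3 → Literature.MathematicalPhysics.KineticTheory.V3), Literature.MathematicalPhysics.KineticTheory.IsHardSphereEulerSolution σ T ρ u θ → ∀ Φ : (N : ℕ) → Literature.Analysis.FluidPDE.HardSphereFlow (Literature.Analysis.FluidPDE.Torus.geometry (Fin 3)) (Literature.MathematicalPhysics.KineticTheory.hsDiameter σ N) (N + 1), Literature.MathematicalPhysics.KineticTheory.TendstoHydroFieldsAt (fun N => Literature.MathematicalPhysics.KineticTheory.localGibbsLaw σ a₁ u₁ θ₁ N (Φ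 N)) Φ ρ u θ 0 → ∀ t ∈ Set.Ico 0 T, ∃ T' : ℝ, t < T' ∧ ∃ (a θ₀ : ℝ → Literature.MathematicalPhysics.KineticTheory.T3 → ℝ) (u₀ : ℝ → Literature.MathematicalPhysics.KineticTheory.T3 → Literature.MathematicalPhysics.KineticTheory.V3) (ρh θh : ℝ → ℝ → Literature.MathematicalPhysics.KineticTheory.T3 → ℝ) (uh : ℝ → ℝ → Literature.MathematicalPhysics.KineticTheory.T3 → Literature.MathematicalPhysics.KineticTheory.V3), Literature.Analysis.FunctionSpaces.Torus.IsSmoothSpaceTimeOn (Set.Icc 0 1) a ∧ Literature.Analysis.FunctionSpaces.Torus.IsSmoothSpaceTimeOn (Set.Icc 0 1) θ₀ ∧ Literature.Analysis.FunctionSpaces.Torus.IsSmoothSpaceTimeOn (Set.Icc 0 1) u₀ ∧ (∀ κ ∈ Set.Icc (0 : ℝ) 1, ∀ x, Λ⁻¹ * (⨅ y, a₁ y) ≤ a κ x ∧ a κ x ≤ Λ * (⨆ y, a₁ y) ∧ 0 < θ₀ κ x) ∧ (∀ x, a 0 x = a 0 0 ∧ θ₀ 0 x = θ₀ 0 0 ∧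 u₀ 0 x = u₀ 0 0) ∧ a 1 = a₁ ∧ θ₀ 1 = θ₁ ∧ u₀ 1 = u₁ ∧ (∀ κ ∈ Set.Icc (0 : ℝ) 1, Literature.MathematicalPhysics.KineticTheory.IsHardSphereEulerSolution σ T' (ρh κ) (uh κ) (θh κ)) ∧ ContDiffOn ℝ ((⊤ : ℕ∞) : WithTop ℕ∞) (fun q : ℝ × ℝ × EuclideanSpace ℝ (Fin 3) => ρh q.1 q.2.1 (Literature.Analysis.FunctionSpaces.Torus.proj q.2.2)) (Set.Icc 0 1 ×ˢ (Set.Ico 0 T' ×ˢ Set.univ)) ∧ ContDiffOn ℝ ((⊤ : ℕ∞) : WithTop ℕ∞) (fun q : ℝ × ℝ × EuclideanSpace ℝ (Fin 3) => uh q.1 q.2.1 (Literature.Analysis.FunctionSpaces.Torus.proj q.2.2)) (Set.Icc 0 1 ×ˢ (Set.Ico 0 T' ×ˢ Set.univ)) ∧ ContDiffOn ℝ ((⊤ : ℕ∞) : WithTop ℕ∞) (fun q : ℝ × ℝ × EuclideanSpace ℝ (Fin 3) => θh q.1 q.2.1 (Literature.Analysis.FunctionSpaces.Torus.proj q.2.2))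 (Set.Icc 0 1 ×ˢ (Set.Ico 0 T' ×ˢ Set.univ)) ∧ (∀ κ ∈ Set.Icc (0 : ℝ) 1, Literature.MathematicalPhysics.KineticTheory.TendstoHydroFieldsAt (fun N => Literature.MathematicalPhysics.KineticTheory.localGibbsLaw σ (a κ) (u₀ κ) (θ₀ κ) N (Φ N)) Φ (ρh κ) (uh κ) (θh κ) 0) ∧ (∀ κ ∈ Set.Icc (0 : ℝ) 1, ∀ N, MeasureTheory.IsProbabilityMeasure (Literature.MathematicalPhysics.KineticTheory.localGibbsLaw σ (a κ) (u₀ κ) (θ₀ κ) N (Φ N))) ∧ ρh 1 = ρ ∧ uh 1 = u ∧ θh 1 = θ ∧ (∀ s ∈ Set.Ico 0 T', ∀ x, ρh 0 s x = ρh 0 0 0 ∧ uh 0 s x = uh 0 0 0 ∧ θh 0 s x = θh 0 0 0)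

-- item stmt-AtomisticToContinuum-3111 · support · rank 9 · closed · moot by None · by planner — informal only, no Lean statement yet:
--   [support] ONE-PARTICLE GREEN'S-FUNCTION RESPONSE (card one-particle-influence, headline object;
--   layer-2 child of ScoreLinearResponse, informal until the definition LinearizedHsEuler lands): in the
--   setting of ScoreLinearResponse let m^κ_t(z₀; χ) := E_{p_κ}[⟨U_N(t),χ⟩ | z₀] − E_{p_κ}⟨U_N(t),χ⟩ be
--   the conditional mean response of the time-t empirical field (density / momentum / energy against χ)
--   to the initial state z₀ = (x₀,v₀) of ONE tagged sphere. Claim: ‖ m^κ_t(z₀; χ) − ⟨𝒢^κ_t[m^κ_0(z₀;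
--   ·)], χ⟩ ‖_{L²(p_κ^{(1)}(dz₀))} = o(1/N) uniformly in κ ∈ [0,1], where 𝒢^κ_t is the solution operator
--   of the

/-- item stmt-AtomisticToContinuum-3077 · assembly · rank 1 · closed · moot by None · by planner
sources: Spohn1991, OllaVaradhanYau1993
[assembly] ScoreLinearResponse → ResamplingInfluence → HardCorePoincare → HomogeneousInvariance →
PreShockHomotopy → HydrodynamicLimit (measure theory + one κ-integration; no physics). -/
@[route_item "route-AtomisticToContinuum-OneParticleInfluence"]
def Assembly : Prop :=
  ScoreLinearResponse → ResamplingInfluence → HardCorePoincare → HomogeneousInvariance → PreShockHomotopy → Literature.MathematicalPhysics.KineticTheory.HydrodynamicLimit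

end Summit.AtomisticToContinuum.HydrodynamicLimit.Theses.OneParticleInfluence
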